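import Mathlib
import HarnessLib
import Summits.Ventures.LatticeQCDFlow.Scaling.AcceptanceVolumeFloorRigidityPi

/-!
# LatticeQCDFlow / Scaling — rigidity of the acceptance volume FLOOR for `m` INDEPENDENT BLOCKS on
# a GENERAL space, II: `∏ᵢ acc(pᵢ, qᵢ) = acc(⊗pᵢ, ⊗qᵢ)` iff all blocks but at most one are
# hit-or-miss almost everywhere

HONEST FRAMING: exact (Metropolis-corrected) sampling algorithms for lattice gauge theory;
figures of merit are autocorrelation/cost numbers at stated couplings and volumes; no
continuum-physics claim.

Venture `LatticeQCDFlow` (cell pub-lqcd), topic `Scaling`; FANOUT row 3 (`s0-u1-a`, S0-B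
implementation A, GEN-14).  NEW WORK of the cell (elementary measure theory), the `m`-block
measure-theoretic form of row 3's finite `prod_accRate_eq_accRate_blockProd_iff`
(`Scaling/AcceptanceVolumeFloorRigidityBlocks`), built on part I
`Scaling/AcceptanceVolumeFloorRigidityPi` (imported: pointwise `prod_min_eq_min_prod_of_cases` /
`prod_min_lt_min_prod`, the threshold `exists_threshold_of_not_hitOrMiss` of a graded block, the
defect `meanAccept_pi_sub_prod_eq_integral` `acc(⊗) − ∏ accᵢ = ∫ (K − L) dM` on `M = (⊗μ)⊗(⊗μ)`)
and row 3's `cases_left_of_weights` (`Scaling/AcceptanceVolumeFloorRigidityIntegralEq`).  SETTING: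
finite block index `ι`, σ-finite block spaces `(X i, μ i)`, block targets `pᵢ ≥ 0` with
`∫ pᵢ dμᵢ = 1`, block models `qᵢ > 0`, `acc(p, q) = ∫∫ min(p(a)q(b), p(b)q(a))`; "hit-or-miss
a.e." is `∃ c, ∀ᵐ a, 0 < p a → p a / q a = c`.  NO definition is introduced.

* **`prod_meanAccept_eq_meanAccept_pi_of_pairwise`** — if of every two distinct blocks at least one
  is hit-or-miss a.e. (all blocks but at most one), then `K = L` `M`-a.e. (each hit-or-miss block
  shows a zero or a tie at a.e. configuration pair, transported along the quasi-measure-preserving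
  coordinate maps) and `∏ᵢ acc(pᵢ, qᵢ) = acc(⊗pᵢ, ⊗qᵢ)`;
* **`prod_meanAccept_lt_meanAccept_pi`** — two distinct blocks `j ≠ k` with graded weights make the
  floor STRICT: with the thresholds `t_j, t_k > 0` of part I, the RECTANGLE of configuration pairs
  `{x : 0 < pᵢ(xᵢ) ∀ i, w_j(x_j) < t_j, t_k < w_k(x_k)} × {x′ : 0 < pᵢ(x′ᵢ) ∀ i, t_j < w_j(x′_j),
  w_k(x′_k) < t_k}` has positive `M`-measure (`Measure.pi_pi`, `Measure.prod_prod`) and carries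
  `K > L` (opposite strict orientations in blocks `j`, `k`, all cross products positive);
* **`prod_meanAccept_eq_meanAccept_pi_iff`** — the equality case; identical blocks
  `pow_meanAccept_eq_meanAccept_pi_const_iff` (`acc₁^m = acc_m ↔ m ≤ 1 ∨` hit-or-miss a.e.).

Reading (value-free): for a flow factorising over independent blocks of a general configuration
space the equilibrium acceptance equals the product of the block acceptances exactly when all blocks
but at most one are all-or-nothing proposals — with part I of row 3's
`Scaling/AcceptanceBhattacharyyaRigidityPi` and `Scaling/AcceptanceVolumeCeilingRigidityIntegralEq`
every face of the general-space sandwich `∏ accᵢ ≤ acc(⊗) ≤ min(minᵢ accᵢ, ∏ BCᵢ²)` is now rigid.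
NOT CLAIMED: a quantitative excess; coupled (non-product) flows; any acceptance of ours; nothing
re-scored.
-/

namespace Summit.Ventures.LatticeQCDFlow.Theory2

open MeasureTheory Finset Filter

variable {ι : Type*} [Fintype ι] {X : ι → Type*} [∀ i, MeasurableSpace (X i)]
  {μ : (i : ι) → Measure (X i)} [∀ i, SigmaFinite (μ i)] {p q : (i : ι) → X i → ℝ}

/-- A hit-or-miss block shows a zero or a tie at `M`-a.e. configuration pair. [ours] -/
theorem ae_cases_of_hitOrMiss (hp0 : ∀ i a, 0 ≤ p i a) (hq0 : ∀ i a, 0 < q i a) {i : ι}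
    (h : ∃ c : ℝ, ∀ᵐ a ∂(μ i), 0 < p i a → p i a / q i a = c) :
    ∀ᵐ e ∂((Measure.pi μ).prod (Measure.pi μ)),
      p i (e.1 i) * q i (e.2 i) = 0 ∨ p i (e.2 i) * q i (e.1 i) = 0 ∨
        p i (e.1 i) * q i (e.2 i) = p i (e.2 i) * q i (e.1 i) := by
  obtain ⟨c, hc⟩ := h
  have h1 : Measure.QuasiMeasurePreserving (fun e : ((i : ι) → X i) × ((i : ι) → X i) => e.1 i)
      ((Measure.pi μ).prod (Measure.pi μ)) (μ i) :=
    (Measure.quasiMeasurePreserving_eval (μ := μ) i).comp Measure.quasiMeasurePreserving_fst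
  have h2 : Measure.QuasiMeasurePreserving (fun e : ((i : ι) → X i) × ((i : ι) → X i) => e.2 i)
      ((Measure.pi μ).prod (Measure.pi μ)) (μ i) :=
    (Measure.quasiMeasurePreserving_eval (μ := μ) i).comp Measure.quasiMeasurePreserving_snd
  filter_upwards [h1.ae hc, h2.ae hc] with e ha hb
  exact cases_left_of_weights (hp0 i) (hq0 i) ha hb

/-- **ALL BLOCKS BUT AT MOST ONE HIT-OR-MISS a.e. ⇒ THE FLOOR IS ATTAINED**:
`∏ᵢ acc(pᵢ, qᵢ) = acc(⊗pᵢ, ⊗qᵢ)`. [ours] -/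
theorem prod_meanAccept_eq_meanAccept_pi_of_pairwise (hp0 : ∀ i a, 0 ≤ p i a)
    (hpm : ∀ i, Measurable (p i)) (hpi : ∀ i, Integrable (p i) (μ i)) (hq0 : ∀ i a, 0 < q i a)
    (hqm : ∀ i, Measurable (q i)) (hqi : ∀ i, Integrable (q i) (μ i))
    (H : ∀ i j, i ≠ j → (∃ c : ℝ, ∀ᵐ a ∂(μ i), 0 < p i a → p i a / q i a = c) ∨
      (∃ c : ℝ, ∀ᵐ a ∂(μ j), 0 < p j a → p j a / q j a = c)) :
    ∏ i, (∫ a, ∫ b, min (p i a * q i b) (p i b * q i a) ∂(μ i) ∂(μ i))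
      = ∫ x, ∫ x', min ((∏ i, p i (x i)) * ∏ i, q i (x' i)) ((∏ i, p i (x' i)) * ∏ i, q i (x i))
          ∂(Measure.pi μ) ∂(Measure.pi μ) := by
  classical
  have hq0' : ∀ i a, 0 ≤ q i a := fun i a => (hq0 i a).le
  -- `L = K` almost everywhere on `M`
  have hKL : ∀ᵐ e ∂((Measure.pi μ).prod (Measure.pi μ)),
      ∏ i, min (p i (e.1 i) * q i (e.2 i)) (p i (e.2 i) * q i (e.1 i))
        = min ((∏ i, p i (e.1 i)) * ∏ i, q i (e.2 i)) ((∏ i, p i (e.2 i)) * ∏ i, q i (e.1 i)) := by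
    rcases isEmpty_or_nonempty ι with hι | ⟨⟨i₀⟩⟩
    · exact Eventually.of_forall fun e => by simp [univ_eq_empty]
    · -- some block `j₀` such that every other block is hit-or-miss a.e.
      have hex : ∃ j₀, ∀ i, i ≠ j₀ → ∃ c : ℝ, ∀ᵐ a ∂(μ i), 0 < p i a → p i a / q i a = c := by
        by_cases hall : ∀ i, ∃ c : ℝ, ∀ᵐ a ∂(μ i), 0 < p i a → p i a / q i a = c
        · exact ⟨i₀, fun i _ => hall i⟩
        · obtain ⟨j₀, hj₀⟩ := not_forall.1 hall
          exact ⟨j₀, fun i hi => (H i j₀ hi).resolve_right hj₀⟩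
      obtain ⟨j₀, hj₀⟩ := hex
      have hae : ∀ᵐ e ∂((Measure.pi μ).prod (Measure.pi μ)), ∀ i, i ≠ j₀ →
          p i (e.1 i) * q i (e.2 i) = 0 ∨ p i (e.2 i) * q i (e.1 i) = 0 ∨
            p i (e.1 i) * q i (e.2 i) = p i (e.2 i) * q i (e.1 i) := by
        refine eventually_all.2 fun i => ?_
        by_cases hi : i = j₀
        · exact Eventually.of_forall fun e h => absurd hi h
        · exact (ae_cases_of_hitOrMiss hp0 hq0 (hj₀ i hi)).mono fun e he _ => he
      filter_upwards [hae] with e he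
      rw [← prod_mul_distrib, ← prod_mul_distrib]
      exact prod_min_eq_min_prod_of_cases (fun i => mul_nonneg (hp0 _ _) (hq0' _ _))
        (fun i => mul_nonneg (hp0 _ _) (hq0' _ _)) j₀ he
  refine (sub_eq_zero.1 ?_).symm
  rw [meanAccept_pi_sub_prod_eq_integral hp0 hpm hpi hq0' hqm hqi]
  refine integral_eq_zero_of_ae ?_
  filter_upwards [hKL] with e he
  rw [Pi.zero_apply, he, sub_self]

/-- **TWO DISTINCT GRADED BLOCKS GAIN STRICTLY**: if blocks `j ≠ k` are both not hit-or-miss a.e.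
then `∏ᵢ acc(pᵢ, qᵢ) < acc(⊗pᵢ, ⊗qᵢ)`. [ours] -/
theorem prod_meanAccept_lt_meanAccept_pi (hp0 : ∀ i a, 0 ≤ p i a) (hpm : ∀ i, Measurable (p i))
    (hpi : ∀ i, Integrable (p i) (μ i)) (hp1 : ∀ i, ∫ a, p i a ∂(μ i) = 1)
    (hq0 : ∀ i a, 0 < q i a) (hqm : ∀ i, Measurable (q i)) (hqi : ∀ i, Integrable (q i) (μ i))
    {j k : ι} (hjk : j ≠ k) (hj : ¬ ∃ c : ℝ, ∀ᵐ a ∂(μ j), 0 < p j a → p j a / q j a = c)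
    (hk : ¬ ∃ c : ℝ, ∀ᵐ a ∂(μ k), 0 < p k a → p k a / q k a = c) :
    ∏ i, (∫ a, ∫ b, min (p i a * q i b) (p i b * q i a) ∂(μ i) ∂(μ i))
      < ∫ x, ∫ x', min ((∏ i, p i (x i)) * ∏ i, q i (x' i)) ((∏ i, p i (x' i)) * ∏ i, q i (x i))
          ∂(Measure.pi μ) ∂(Measure.pi μ) := by
  classical
  have hq0' : ∀ i a, 0 ≤ q i a := fun i a => (hq0 i a).le
  obtain ⟨tj, htj, hUj, hVj⟩ :=
    exists_threshold_of_not_hitOrMiss (hp0 j) (hpm j) (hp1 j) (hq0 j) (hqm j) hj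
  obtain ⟨tk, htk, hUk, hVk⟩ :=
    exists_threshold_of_not_hitOrMiss (hp0 k) (hpm k) (hp1 k) (hq0 k) (hqm k) hk
  -- every block carries positive target mass
  have hG : ∀ i, μ i {a | 0 < p i a} ≠ 0 := fun i h0 => by
    have hae : (fun a => p i a) =ᵐ[μ i] fun _ => (0 : ℝ) := by
      filter_upwards [measure_eq_zero_iff_ae_notMem.1 h0] with a ha
      exact le_antisymm (not_lt.1 ha) (hp0 i a)
    have h1 := hp1 i
    rw [integral_congr_ae hae, integral_const, smul_zero] at h1
    exact zero_ne_one h1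
  have hpos_of_gt : ∀ i a (t : ℝ), 0 < t → t < p i a / q i a → 0 < p i a := fun i a t ht h => by
    by_contra hle
    have h0 : p i a = 0 := le_antisymm (not_lt.1 hle) (hp0 i a)
    rw [h0, zero_div] at h
    exact lt_irrefl _ (ht.trans h)
  -- the two sides of the rectangle, block by block (no transport of block types)
  let s : (i : ι) → Set (X i) := fun i =>
    {a | 0 < p i a ∧ (i = j → p i a / q i a < tj) ∧ (i = k → tk < p i a / q i a)}
  let s' : (i : ι) → Set (X i) := fun i =>
    {a | 0 < p i a ∧ (i = j → tj < p i a / q i a) ∧ (i = k → p i a / q i a < tk)}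
  have hsi : ∀ i, μ i (s i) ≠ 0 := by
    intro i h0
    by_cases hij : i = j
    · subst hij
      refine hUj (measure_mono_null (fun a ha => ?_) h0)
      exact ⟨ha.1, fun _ => ha.2, fun h => absurd h hjk⟩
    by_cases hik : i = k
    · subst hik
      refine hVk (measure_mono_null (fun a ha => ?_) h0)
      exact ⟨hpos_of_gt _ a tk htk ha, fun h => absurd h hij, fun _ => ha⟩
    · refine hG i (measure_mono_null (fun a ha => ?_) h0)
      exact ⟨ha, fun h => absurd h hij, fun h => absurd h hik⟩
  have hs'i : ∀ i, μ i (s' i) ≠ 0 := by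
    intro i h0
    by_cases hij : i = j
    · subst hij
      refine hVj (measure_mono_null (fun a ha => ?_) h0)
      exact ⟨hpos_of_gt _ a tj htj ha, fun _ => ha, fun h => absurd h hjk⟩
    by_cases hik : i = k
    · subst hik
      refine hUk (measure_mono_null (fun a ha => ?_) h0)
      exact ⟨ha.1, fun h => absurd h hij, fun _ => ha.2⟩
    · refine hG i (measure_mono_null (fun a ha => ?_) h0)
      exact ⟨ha, fun h => absurd h hij, fun h => absurd h hik⟩
  -- the rectangle is charged
  have hM : ((Measure.pi μ).prod (Measure.pi μ)) (Set.pi Set.univ s ×ˢ Set.pi Set.univ s') ≠ 0 := by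
    rw [Measure.prod_prod, Measure.pi_pi, Measure.pi_pi]
    exact mul_ne_zero (prod_ne_zero_iff.2 fun i _ => hsi i) (prod_ne_zero_iff.2 fun i _ => hs'i i)
  -- the defect integrand: nonnegative, integrable, positive on the rectangle
  set f : ((i : ι) → X i) × ((i : ι) → X i) → ℝ := fun e =>
    min ((∏ i, p i (e.1 i)) * ∏ i, q i (e.2 i)) ((∏ i, p i (e.2 i)) * ∏ i, q i (e.1 i))
      - ∏ i, min (p i (e.1 i) * q i (e.2 i)) (p i (e.2 i) * q i (e.1 i)) with hfdef
  have hf0 : ∀ e, 0 ≤ f e := fun e => sub_nonneg.2 (piBlockKernelProd_le_piKernel hp0 hq0' e)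
  have hfi : Integrable f ((Measure.pi μ).prod (Measure.pi μ)) :=
    (integrable_piKernel hp0 hpm hpi hq0' hqm hqi).sub
      (integrable_piBlockKernelProd hp0 hpm hpi hq0' hqm hqi)
  have hfpos : ∀ e ∈ Set.pi Set.univ s ×ˢ Set.pi Set.univ s', 0 < f e := by
    rintro ⟨x, x'⟩ ⟨hx, hx'⟩
    have hxi : ∀ i, x i ∈ s i := fun i => hx i (Set.mem_univ i)
    have hx'i : ∀ i, x' i ∈ s' i := fun i => hx' i (Set.mem_univ i)
    have hA : ∀ i, 0 < p i (x i) * q i (x' i) := fun i => mul_pos (hxi i).1 (hq0 _ _)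
    have hB : ∀ i, 0 < p i (x' i) * q i (x i) := fun i => mul_pos (hx'i i).1 (hq0 _ _)
    have hjlt : p j (x j) * q j (x' j) < p j (x' j) * q j (x j) := by
      rw [← div_lt_div_iff₀ (hq0 j (x j)) (hq0 j (x' j))]
      exact ((hxi j).2.1 rfl).trans ((hx'i j).2.1 rfl)
    have hklt : p k (x' k) * q k (x k) < p k (x k) * q k (x' k) := by
      rw [← div_lt_div_iff₀ (hq0 k (x' k)) (hq0 k (x k))]
      exact ((hx'i k).2.2 rfl).trans ((hxi k).2.2 rfl)
    have hlt := prod_min_lt_min_prod hA hB hjk hjlt hklt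
    rw [hfdef]
    simp only
    rw [← prod_mul_distrib, ← prod_mul_distrib]
    exact sub_pos.2 hlt
  -- hence the defect integral is positive
  have hne : ∫ e, f e ∂((Measure.pi μ).prod (Measure.pi μ)) ≠ 0 := fun h0 => by
    have hae : f =ᵐ[(Measure.pi μ).prod (Measure.pi μ)] 0 :=
      (integral_eq_zero_iff_of_nonneg hf0 hfi).1 h0
    exact hM (measure_eq_zero_iff_ae_notMem.2 (hae.mono fun e he heS => (hfpos e heS).ne' he))
  have hpos : 0 < ∫ e, f e ∂((Measure.pi μ).prod (Measure.pi μ)) :=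
    lt_of_le_of_ne (integral_nonneg hf0) (Ne.symm hne)
  rw [hfdef, ← meanAccept_pi_sub_prod_eq_integral hp0 hpm hpi hq0' hqm hqi] at hpos
  exact sub_pos.1 hpos

/-- **RIGIDITY OF THE ACCEPTANCE VOLUME FLOOR FOR `m` INDEPENDENT BLOCKS (general space)**: for
normalised nonnegative block targets and positive integrable block models on σ-finite block spaces,
`∏ᵢ acc(pᵢ, qᵢ) = acc(⊗pᵢ, ⊗qᵢ)` iff of every two distinct blocks at least one is hit-or-miss
a.e. — ALL BLOCKS BUT AT MOST ONE ARE HIT-OR-MISS. [ours] -/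
theorem prod_meanAccept_eq_meanAccept_pi_iff (hp0 : ∀ i a, 0 ≤ p i a) (hpm : ∀ i, Measurable (p i))
    (hpi : ∀ i, Integrable (p i) (μ i)) (hp1 : ∀ i, ∫ a, p i a ∂(μ i) = 1)
    (hq0 : ∀ i a, 0 < q i a) (hqm : ∀ i, Measurable (q i)) (hqi : ∀ i, Integrable (q i) (μ i)) :
    ∏ i, (∫ a, ∫ b, min (p i a * q i b) (p i b * q i a) ∂(μ i) ∂(μ i))
      = ∫ x, ∫ x', min ((∏ i, p i (x i)) * ∏ i, q i (x' i)) ((∏ i, p i (x' i)) * ∏ i, q i (x i))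
          ∂(Measure.pi μ) ∂(Measure.pi μ) ↔
      ∀ i j, i ≠ j → (∃ c : ℝ, ∀ᵐ a ∂(μ i), 0 < p i a → p i a / q i a = c) ∨
        (∃ c : ℝ, ∀ᵐ a ∂(μ j), 0 < p j a → p j a / q j a = c) := by
  refine ⟨fun h i j hij => ?_, prod_meanAccept_eq_meanAccept_pi_of_pairwise hp0 hpm hpi hq0 hqm hqi⟩
  by_contra hne
  obtain ⟨hi, hj⟩ := not_or.1 hne
  exact (prod_meanAccept_lt_meanAccept_pi hp0 hpm hpi hp1 hq0 hqm hqi hij hi hj).ne h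

/-! ## Identical blocks -/

/-- **Identical blocks**: for `m = card ι` independent copies of one block flow,
`acc(p, q)^m = acc(p^{⊗m}, q^{⊗m})` iff `m ≤ 1` or the block flow is hit-or-miss a.e. [ours] -/
theorem pow_meanAccept_eq_meanAccept_pi_const_iff {Y : Type*} [MeasurableSpace Y] {ν : Measure Y}
    [SigmaFinite ν] {p q : Y → ℝ} (hp0 : ∀ a, 0 ≤ p a) (hpm : Measurable p) (hpi : Integrable p ν)
    (hp1 : ∫ a, p a ∂ν = 1) (hq0 : ∀ a, 0 < q a) (hqm : Measurable q) (hqi : Integrable q ν) :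
    (∫ a, ∫ b, min (p a * q b) (p b * q a) ∂ν ∂ν) ^ Fintype.card ι
      = ∫ x, ∫ x', min ((∏ i : ι, p (x i)) * ∏ i, q (x' i)) ((∏ i, p (x' i)) * ∏ i, q (x i))
          ∂(Measure.pi fun _ : ι => ν) ∂(Measure.pi fun _ : ι => ν) ↔
      Fintype.card ι ≤ 1 ∨ ∃ c : ℝ, ∀ᵐ a ∂ν, 0 < p a → p a / q a = c := by
  have h := prod_meanAccept_eq_meanAccept_pi_iff (ι := ι) (X := fun _ => Y) (μ := fun _ : ι => ν)
    (p := fun _ => p) (q := fun _ => q) (fun _ => hp0) (fun _ => hpm) (fun _ => hpi) (fun _ => hp1)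
    (fun _ => hq0) (fun _ => hqm) fun _ => hqi
  rw [prod_const, card_univ] at h
  rw [h]
  simp only [or_self]
  constructor
  · intro h'
    by_cases hc : Fintype.card ι ≤ 1
    · exact Or.inl hc
    · obtain ⟨i, j, hij⟩ := Fintype.exists_pair_of_one_lt_card (not_le.1 hc)
      exact Or.inr (h' i j hij)
  · rintro (hc | hc) i j hij
    · exact absurd (Fintype.card_le_one_iff.1 hc i j) hij
    · exact hc

end Summit.Ventures.LatticeQCDFlow.Theory2
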